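import Literature.Analysis.FluidPDE.ElgindiProductLeibniz
import Literature.Analysis.FluidPDE.ElgindiAngularEmbedding
import Literature.Analysis.FluidPDE.ElgindiRadialEmbedding
import Literature.Analysis.FluidPDE.ElgindiAngularIdentification
import Literature.Analysis.FluidPDE.ElgindiCommutatorCalculus
import Literature.Analysis.FluidPDE.ElgindiEllipticHkTools
import Literature.Analysis.FluidPDE.ElgindiHkTools
import Literature.Analysis.FluidPDE.ElgindiAngularDataBound
import Literature.Analysis.FluidPDE.ElgindiStripCalculusTwo
import Literature.Analysis.FluidPDE.ElgindiOperatorLocality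
import Literature.Analysis.FluidPDE.ElgindiTensorHk
import HarnessLib

/-!
# `L^∞` bounds for test functions of the strip from the `𝓗⁴` functional
([ElgindiGhoulMasmoudi2021] §9 Lemma 9.1 and its use in Proposition 9.2)

Topic `Literature/Analysis/FluidPDE`. Support file (definitions with bodies and proved theorems, no
named facts) on the proof path of the named fact
`Literature.Analysis.FluidPDE.Elgindi.ElgindiGhoulMasmoudi2021_stabilityCore`
(`ElgindiStabilityDecomposition.lean`). Elgindi–Ghoul–Masmoudi, arXiv:1910.14071, §9 (p. 20):
Lemma 9.1 (both embeddings) and the proof of Proposition 9.2 ("we just put it in `L^∞` and pull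
it out of the integral … `I ≤ (∫ sup_z|∂_θg|²sin(2θ)^{2−γ}dθ)(∫ sup_θ|D_z³f|²(1+z)⁴/z⁴dz)`").

For a test function `h` of the strip (`StripTest`): the pointwise bound
`h(z,θ)² ≤ (π/(3(γ−1)))·‖D_θD_zh·W‖²_{L²}` (`sq_le_mixed11`, `γ = 1 + α/10`), hence for the words
`D_θ^{a}D_z^{b}u` with `a + b ≤ 2` the bound by `|u|²_{𝓗⁴}` (`sq_word_le_eHkNormSq`), and the
separated bound for the awkward term
`∫∫ w²(D_θu)²(D_z³v)²s^{−γ} ≤ (π/(3(γ−1)))|u|²_{𝓗⁴}|v|²_{𝓗⁴}` (`lintegral_awkward_le`).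
-/

noncomputable section

open MeasureTheory Set Function Real Filter Finset
open _root_.Topology
open scoped ENNReal

namespace Literature.Analysis.FluidPDE

namespace Elgindi

/-! ### Test functions of the strip -/

/-- **Test functions of the strip**: smooth, compactly supported inside the open strip. [folklore] -/
structure StripTest (f : ℝ → ℝ → ℝ) : Prop where
  smooth : Smooth2 f
  supp : HasCompactSupport (uncurry f)
  sub : tsupport (uncurry f) ⊆ strip

namespace StripTest

variable {f : ℝ → ℝ → ℝ} (hf : StripTest f)
include hf

/-- Closure under `D_z`. [folklore] -/
theorem ofDz : StripTest (Dz f) := ⟨hf.smooth.ofDz, hasCompactSupport_Dz hf.supp, tsupport_Dz_subset.trans hf.sub⟩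

/-- Closure under `D_θ`. [folklore] -/
theorem ofDθ : StripTest (Dθ f) := ⟨hf.smooth.ofDθ, hasCompactSupport_Dθ hf.supp, tsupport_Dθ_subset.trans hf.sub⟩

/-- Closure under the words. [folklore] -/
theorem ofWord (i j : ℕ) : StripTest (Dθ^[i] (Dz^[j] f)) :=
  ⟨hf.smooth.ofWord i j, hasCompactSupport_iterate_Dθ_Dz hf.supp i j, (tsupport_iterate_Dθ_Dz_subset i j).trans hf.sub⟩

/-- Radial slices are `C¹`, compactly supported inside `(0,∞)`. [folklore] -/
theorem slice_z (θ : ℝ) : ContDiff ℝ 1 (fun z => f z θ) ∧ HasCompactSupport (fun z => f z θ) ∧ tsupport (fun z => f z θ) ⊆ Ioi 0 := by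
  have hK : IsCompact (Prod.fst '' tsupport (uncurry f)) := hf.supp.image continuous_fst
  have hsub : support (fun z => f z θ) ⊆ Prod.fst '' tsupport (uncurry f) := fun z hz =>
    ⟨(z, θ), subset_tsupport _ (by simpa [mem_support] using hz), rfl⟩
  have hts : tsupport (fun z => f z θ) ⊆ Prod.fst '' tsupport (uncurry f) := closure_minimal hsub hK.isClosed
  refine ⟨(hf.smooth 1).comp (contDiff_id.prodMk contDiff_const), HasCompactSupport.of_support_subset_isCompact hK hsub, fun z hz => ?_⟩
  obtain ⟨p, hp, rfl⟩ := hts hz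
  exact (hf.sub hp).1

/-- Angular slices are `C¹`, compactly supported inside `(0,π/2)`. [folklore] -/
theorem slice_θ (z : ℝ) : ContDiff ℝ 1 (fun θ => f z θ) ∧ HasCompactSupport (fun θ => f z θ) ∧ tsupport (fun θ => f z θ) ⊆ Ioo 0 (π / 2) := by
  have hK : IsCompact (Prod.snd '' tsupport (uncurry f)) := hf.supp.image continuous_snd
  have hsub : support (fun θ => f z θ) ⊆ Prod.snd '' tsupport (uncurry f) := fun θ hθ =>
    ⟨(z, θ), subset_tsupport _ (by simpa [mem_support] using hθ), rfl⟩
  have hts : tsupport (fun θ => f z θ) ⊆ Prod.snd '' tsupport (uncurry f) := closure_minimal hsub hK.isClosed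
  refine ⟨(hf.smooth 1).comp (contDiff_const.prodMk contDiff_id), HasCompactSupport.of_support_subset_isCompact hK hsub, fun θ hθ => ?_⟩
  obtain ⟨p, hp, rfl⟩ := hts hθ
  exact (hf.sub hp).2

/-- **Angular embedding on slices** (Lemma 9.1, first part): `h(z,θ)² ≤ (π/(γ−1))∫(∂_θh(z,t))²s(t)^{2−γ}dt`. [cite: ElgindiGhoulMasmoudi2021, §9 Lemma 9.1 (p. 20 of arXiv:1910.14071)] -/
theorem sq_le_angular {γ : ℝ} (hγ1 : 1 < γ) (hγ2 : γ ≤ 2) (z θ : ℝ) :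
    f z θ ^ 2 ≤ π / (γ - 1) * ∫ t in Ioo 0 (π / 2), dθ f z t ^ 2 * Real.sin (2 * t) ^ (2 - γ) := by
  obtain ⟨h1, h2, h3⟩ := hf.slice_θ z
  exact sq_le_integral_sq_deriv_angular hγ1 hγ2 h1 h2 h3 θ

/-- **Radial embedding on slices** (Lemma 9.1, second part): `h(z,θ)² ≤ ⅓∫(D_zh(s,θ)w(s))²ds`. [cite: ElgindiGhoulMasmoudi2021, §9 Lemma 9.1 (p. 20 of arXiv:1910.14071)] -/
theorem sq_le_radial (z θ : ℝ) : f z θ ^ 2 ≤ 1 / 3 * ∫ s in Ioi (0:ℝ), (Dz f s θ * radialWeight s) ^ 2 := by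
  obtain ⟨h1, h2, h3⟩ := hf.slice_z θ
  exact sq_le_integral_sq_Dz₁ h1 h2 h3 z

/-- Closure under `∂_θ`. [folklore] -/
theorem ofdθ : StripTest (dθ f) :=
  ⟨fun n => contDiff_dθ_of_contDiff (hf.smooth (n + 1)), hasCompactSupport_iterate_dθ hf.supp 1, (tsupport_iterate_dθ_subset 1).trans hf.sub⟩

/-- Smoothness on the strip. [folklore] -/
theorem contDiffOn (n : ℕ) : ContDiffOn ℝ n (uncurry f) strip := (hf.smooth n).contDiffOn

end StripTest

/-! ### Integral bookkeeping -/

/-- `ofReal(∫g) ≤ ∫⁻ofReal(g)` on a set, for any real `g`. [folklore] -/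
theorem ofReal_setIntegral_le_lintegral {g : ℝ → ℝ} {s : Set ℝ} (hg : ∀ x ∈ s, 0 ≤ g x) (hs : MeasurableSet s) :
    ENNReal.ofReal (∫ x in s, g x) ≤ ∫⁻ x in s, ENNReal.ofReal (g x) := by
  by_cases hi : Integrable g (volume.restrict s)
  · rw [ofReal_integral_eq_lintegral_ofReal hi ((ae_restrict_iff' hs).2 (ae_of_all _ hg))]
  · rw [integral_undef hi]; simp

/-- Tonelli on the strip, `θ` outside: `∫∫_strip F = ∫_θ∫_z F`. [folklore] -/
theorem lintegral_strip_eq_theta_radial {F : ℝ × ℝ → ℝ≥0∞} (hF : Measurable F) :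
    ∫⁻ p in strip, F p = ∫⁻ t in Ioo 0 (π / 2), ∫⁻ z in Ioi 0, F (z, t) := by
  have hprod : (volume.restrict strip : Measure (ℝ × ℝ)) = (volume.restrict (Ioi (0:ℝ))).prod (volume.restrict (Ioo 0 (π / 2))) := by
    rw [show strip = Ioi (0:ℝ) ×ˢ Ioo 0 (π / 2) from rfl, Measure.volume_eq_prod, Measure.prod_restrict]
  rw [hprod, lintegral_prod_symm' _ hF]

/-- Tonelli on the strip, `z` outside: `∫∫_strip F = ∫_z∫_θ F`. [folklore] -/
theorem lintegral_strip_eq_radial_theta {F : ℝ × ℝ → ℝ≥0∞} (hF : Measurable F) :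
    ∫⁻ p in strip, F p = ∫⁻ z in Ioi 0, ∫⁻ t in Ioo 0 (π / 2), F (z, t) := by
  have hprod : (volume.restrict strip : Measure (ℝ × ℝ)) = (volume.restrict (Ioi (0:ℝ))).prod (volume.restrict (Ioo 0 (π / 2))) := by
    rw [show strip = Ioi (0:ℝ) ×ˢ Ioo 0 (π / 2) from rfl, Measure.volume_eq_prod, Measure.prod_restrict]
  rw [hprod, lintegral_prod _ hF.aemeasurable]

/-- `∂_θD_z = D_z∂_θ` on the strip for smooth functions. [folklore] -/
theorem dθ_Dz_eq_Dz_dθ {f : ℝ → ℝ → ℝ} (hf : Smooth2 f) {p : ℝ × ℝ} (hp : p ∈ strip) : dθ (Dz f) p.1 p.2 = Dz (dθ f) p.1 p.2 := by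
  have h2 : ContDiffOn ℝ 2 (uncurry f) strip := (hf 2).contDiffOn
  rw [Dz_eq_mul_dz, ← dθ_dz_eq_dz_dθ h2 hp]
  show deriv (fun t => p.1 * dz f p.1 t) p.2 = p.1 * dθ (dz f) p.1 p.2
  rw [deriv_const_mul_field]; rfl

/-- The square of the mixed term `(1,1)` on the strip, through `D_z∂_θ`: `(D_θD_zf·W)² = w²(D_z∂_θf)²s^{2−γ}`. [folklore] -/
theorem sq_hkMixedTerm_one_one {α : ℝ} {f : ℝ → ℝ → ℝ} (hf : Smooth2 f) {p : ℝ × ℝ} (hp : p ∈ strip) :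
    (hkMixedTerm α 1 1 f p.1 p.2) ^ 2 = radialWeight p.1 ^ 2 * (Dz (dθ f) p.1 p.2) ^ 2 * Real.sin (2 * p.2) ^ (2 - gammaExp α) := by
  rw [sq_hkMixedTerm α 1 1 f hp]
  simp only [Function.iterate_one]
  rw [Dθ_apply, show deriv (fun θ' => Dz f p.1 θ') p.2 = dθ (Dz f) p.1 p.2 from rfl, dθ_Dz_eq_Dz_dθ hf hp]
  have e := sin_pow_mul_rpow_neg hp 1 (gammaExp α)
  norm_num at e
  rw [← e]; ring

/-- The square of a mixed term `(1,j)` on the strip: `(D_θD_z^jf·W)² = w²(∂_θD_z^jf)²s^{2−γ}`. [folklore] -/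
theorem sq_hkMixedTerm_one (α : ℝ) (j : ℕ) (f : ℝ → ℝ → ℝ) {p : ℝ × ℝ} (hp : p ∈ strip) :
    (hkMixedTerm α 1 j f p.1 p.2) ^ 2 = radialWeight p.1 ^ 2 * (dθ (Dz^[j] f) p.1 p.2) ^ 2 * Real.sin (2 * p.2) ^ (2 - gammaExp α) := by
  rw [sq_hkMixedTerm α 1 j f hp]
  simp only [Function.iterate_one]
  rw [Dθ_apply, show deriv (fun θ' => (Dz^[j] f) p.1 θ') p.2 = dθ (Dz^[j] f) p.1 p.2 from rfl]
  have e := sin_pow_mul_rpow_neg hp 1 (gammaExp α)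
  norm_num at e
  rw [← e]; ring

/-! ### The combined `L^∞` bound -/

/-- **`h(z,θ)² ≤ (π/(3(γ−1)))·‖D_θD_zh·W‖²_{L²(strip)}`** for a test function `h` (`γ = 1 + α/10`,
`0 < α ≤ 10`). [cite: ElgindiGhoulMasmoudi2021, §9 Lemma 9.1 and the proof of Proposition 9.2 (p. 20 of arXiv:1910.14071)] -/
theorem sq_le_mixed11 {α : ℝ} (hα : 0 < α) (hα10 : α ≤ 10) {f : ℝ → ℝ → ℝ} (hf : StripTest f) (z θ : ℝ) :
    ENNReal.ofReal (f z θ ^ 2) ≤ ENNReal.ofReal (π / (3 * (gammaExp α - 1))) * eL2Sq (hkMixedTerm α 1 1 f) := by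
  set γ := gammaExp α with hγ
  have hγ1 : 1 < γ := by unfold gammaExp at hγ; rw [hγ]; linarith
  have hγ2 : γ ≤ 2 := by unfold gammaExp at hγ; rw [hγ]; linarith
  have hc1 : 0 ≤ π / (γ - 1) := div_nonneg Real.pi_pos.le (by linarith)
  -- angular embedding
  have h1 := hf.sq_le_angular hγ1 hγ2 z θ
  -- radial embedding on every slice of `∂_θf`
  have h2 : ∀ t, dθ f z t ^ 2 ≤ 1 / 3 * ∫ s in Ioi (0:ℝ), (Dz (dθ f) s t * radialWeight s) ^ 2 := fun t => hf.ofdθ.sq_le_radial z t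
  -- measurability of the strip integrand
  have hmeasH : Measurable fun q : ℝ × ℝ => ENNReal.ofReal ((Dz (dθ f) q.1 q.2 * radialWeight q.1) ^ 2 * Real.sin (2 * q.2) ^ (2 - γ)) := by
    have c1 : Measurable fun q : ℝ × ℝ => Dz (dθ f) q.1 q.2 := (hf.ofdθ.smooth.ofDz 0).continuous.measurable
    have c2 : Measurable fun q : ℝ × ℝ => radialWeight q.1 := by unfold radialWeight; fun_prop
    have c3 : Measurable fun q : ℝ × ℝ => Real.sin (2 * q.2) ^ (2 - γ) := by fun_prop
    exact (((c1.mul c2).pow_const 2).mul c3).ennreal_ofReal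
  -- step 1: angular embedding in `ℝ≥0∞`
  have s1 : ENNReal.ofReal (f z θ ^ 2) ≤ ENNReal.ofReal (π / (γ - 1)) * ∫⁻ t in Ioo 0 (π / 2), ENNReal.ofReal (dθ f z t ^ 2 * Real.sin (2 * t) ^ (2 - γ)) := by
    refine (ENNReal.ofReal_le_ofReal h1).trans ?_
    rw [ENNReal.ofReal_mul hc1]
    refine mul_le_mul_right ?_ _
    refine ofReal_setIntegral_le_lintegral (fun t ht => ?_) measurableSet_Ioo
    have : 0 ≤ Real.sin (2 * t) ^ (2 - γ) := Real.rpow_nonneg (Real.sin_pos_of_pos_of_lt_pi (by linarith [ht.1]) (by linarith [ht.2])).le _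
    positivity
  -- step 2: radial embedding inside, then Tonelli
  have s2 : ∫⁻ t in Ioo 0 (π / 2), ENNReal.ofReal (dθ f z t ^ 2 * Real.sin (2 * t) ^ (2 - γ)) ≤
      ENNReal.ofReal (1 / 3) * ∫⁻ t in Ioo 0 (π / 2), ∫⁻ s in Ioi (0:ℝ), ENNReal.ofReal ((Dz (dθ f) s t * radialWeight s) ^ 2 * Real.sin (2 * t) ^ (2 - γ)) := by
    rw [← lintegral_const_mul' _ _ ENNReal.ofReal_ne_top]
    refine setLIntegral_mono' measurableSet_Ioo fun t ht => ?_
    have hst : 0 ≤ Real.sin (2 * t) ^ (2 - γ) := Real.rpow_nonneg (Real.sin_pos_of_pos_of_lt_pi (by linarith [ht.1]) (by linarith [ht.2])).le _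
    have hI0 : ∀ s ∈ Ioi (0:ℝ), 0 ≤ (Dz (dθ f) s t * radialWeight s) ^ 2 * Real.sin (2 * t) ^ (2 - γ) := fun s _ => by positivity
    calc ENNReal.ofReal (dθ f z t ^ 2 * Real.sin (2 * t) ^ (2 - γ))
        ≤ ENNReal.ofReal ((1 / 3 * ∫ s in Ioi (0:ℝ), (Dz (dθ f) s t * radialWeight s) ^ 2) * Real.sin (2 * t) ^ (2 - γ)) :=
          ENNReal.ofReal_le_ofReal (mul_le_mul_of_nonneg_right (h2 t) hst)
      _ = ENNReal.ofReal (1 / 3) * ENNReal.ofReal (∫ s in Ioi (0:ℝ), (Dz (dθ f) s t * radialWeight s) ^ 2 * Real.sin (2 * t) ^ (2 - γ)) := by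
          rw [mul_assoc, ← MeasureTheory.integral_mul_const, ← ENNReal.ofReal_mul (by norm_num)]
      _ ≤ ENNReal.ofReal (1 / 3) * ∫⁻ s in Ioi (0:ℝ), ENNReal.ofReal ((Dz (dθ f) s t * radialWeight s) ^ 2 * Real.sin (2 * t) ^ (2 - γ)) :=
          mul_le_mul_right (ofReal_setIntegral_le_lintegral hI0 measurableSet_Ioi) _
  -- step 3: the double integral is the mixed term `(1,1)`
  have s3 : ∫⁻ t in Ioo 0 (π / 2), ∫⁻ s in Ioi (0:ℝ), ENNReal.ofReal ((Dz (dθ f) s t * radialWeight s) ^ 2 * Real.sin (2 * t) ^ (2 - γ)) = eL2Sq (hkMixedTerm α 1 1 f) := by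
    rw [← lintegral_strip_eq_theta_radial hmeasH, eL2Sq_eq_lintegral_ofReal]
    refine setLIntegral_congr_fun measurableSet_strip fun q hq => ?_
    rw [sq_hkMixedTerm_one_one hf.smooth hq]; congr 1; ring
  calc ENNReal.ofReal (f z θ ^ 2)
      ≤ ENNReal.ofReal (π / (γ - 1)) * (ENNReal.ofReal (1 / 3) * eL2Sq (hkMixedTerm α 1 1 f)) := by
        rw [← s3]; exact s1.trans (mul_le_mul_right s2 _)
    _ = ENNReal.ofReal (π / (3 * (γ - 1))) * eL2Sq (hkMixedTerm α 1 1 f) := by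
        rw [← mul_assoc, ← ENNReal.ofReal_mul hc1]; congr 1; congr 1
        field_simp

/-- **The words `D_θ^aD_z^bu`, `a + b ≤ 2`, are bounded by `|u|²_{𝓗⁴}`:**
`(D_θ^aD_z^bu)(z,θ)² ≤ (π/(3(γ−1)))|u|²_{𝓗⁴}`. [cite: ElgindiGhoulMasmoudi2021, §9 proof of Proposition 9.4: "|D^jg|_{L^∞} ≤ C/√(γ−1)|g|_{𝓗ᵏ} whenever j ≤ k−2" (p. 20 of arXiv:1910.14071)] -/
theorem sq_word_le_eHkNormSq {α : ℝ} (hα : 0 < α) (hα10 : α ≤ 10) {u : ℝ → ℝ → ℝ} (hu : StripTest u) {a b : ℕ} (hab : a + b ≤ 2) (z θ : ℝ) :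
    ENNReal.ofReal ((Dθ^[a] (Dz^[b] u)) z θ ^ 2) ≤ ENNReal.ofReal (π / (3 * (gammaExp α - 1))) * eHkNormSq α 4 u := by
  have hw : StripTest (Dθ^[a] (Dz^[b] u)) := hu.ofWord a b
  refine (sq_le_mixed11 hα hα10 hw z θ).trans (mul_le_mul_right ?_ _)
  -- `hkMixedTerm 1 1 (D_θ^aD_z^bu) = hkMixedTerm (a+1) (b+1) u` on the strip
  have e : ∀ p ∈ strip, hkMixedTerm α 1 1 (Dθ^[a] (Dz^[b] u)) p.1 p.2 = hkMixedTerm α (a + 1) (b + 1) u p.1 p.2 := by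
    intro p hp
    simp only [hkMixedTerm, Function.iterate_one]
    congr 1
    -- `D_θ(D_z(D_θ^a D_z^b u)) = D_θ^{a+1}(D_z^{b+1}u)` at `p`
    have hc : ∀ q ∈ strip, Dz (Dθ^[a] (Dz^[b] u)) q.1 q.2 = (Dθ^[a] (Dz^[b + 1] u)) q.1 q.2 := by
      intro q hq
      rw [Dz_iterate_Dθ (N := a + 2) ((hu.smooth.ofIterDz b) (a + 2)).contDiffOn le_rfl q hq, Function.iterate_succ_apply']
    rw [Function.iterate_succ_apply' Dθ a, show Dθ (Dz (Dθ^[a] (Dz^[b] u))) p.1 p.2 = Dθ (Dθ^[a] (Dz^[b + 1] u)) p.1 p.2 from ?_]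
    show Real.sin (2 * p.2) * dθ (Dz (Dθ^[a] (Dz^[b] u))) p.1 p.2 = Real.sin (2 * p.2) * dθ (Dθ^[a] (Dz^[b + 1] u)) p.1 p.2
    rw [eqOn_dθ isOpen_strip hc hp]
  rw [eL2Sq_congr_strip e]
  exact eL2Sq_hkMixedTerm_le α (k := 4) (by omega) (by omega) u

/-! ### The awkward term -/

set_option maxHeartbeats 1600000 in
/-- **The separated bound for the awkward term** `I = ∫∫ w²(D_θu)²(D_z³v)²s^{−γ}`:
`I ≤ (π/(3(γ−1)))|u|²_{𝓗⁴}|v|²_{𝓗⁴}`. [cite: ElgindiGhoulMasmoudi2021, §9 proof of Proposition 9.2, the term I (p. 20 of arXiv:1910.14071)] -/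
theorem lintegral_awkward_le {α : ℝ} (hα : 0 < α) (hα10 : α ≤ 10) {u v : ℝ → ℝ → ℝ} (hu : StripTest u) (hv : StripTest v) :
    ∫⁻ p in strip, ENNReal.ofReal (radialWeight p.1 ^ 2 * (Dθ u p.1 p.2) ^ 2 * ((Dz^[3] v) p.1 p.2) ^ 2 * Real.sin (2 * p.2) ^ (-gammaExp α)) ≤
      ENNReal.ofReal (π / (3 * (gammaExp α - 1))) * (eHkNormSq α 4 u * eHkNormSq α 4 v) := by
  set γ := gammaExp α with hγ
  have hγ1 : 1 < γ := by unfold gammaExp at hγ; rw [hγ]; linarith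
  have hγ2 : γ ≤ 2 := by unfold gammaExp at hγ; rw [hγ]; linarith
  have hc1 : 0 ≤ π / (γ - 1) := div_nonneg Real.pi_pos.le (by linarith)
  have hv3 : StripTest (Dz^[3] v) := hv.ofWord 0 3
  -- the two parametric bounds
  set A : ℝ → ℝ≥0∞ := fun t => ∫⁻ s in Ioi (0:ℝ), ENNReal.ofReal ((Dz (dθ u) s t * radialWeight s) ^ 2 * Real.sin (2 * t) ^ (2 - γ)) with hA
  set B : ℝ → ℝ≥0∞ := fun z => ∫⁻ τ in Ioo 0 (π / 2), ENNReal.ofReal (radialWeight z ^ 2 * dθ (Dz^[3] v) z τ ^ 2 * Real.sin (2 * τ) ^ (2 - γ)) with hB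
  have mA' : Measurable fun q : ℝ × ℝ => ENNReal.ofReal ((Dz (dθ u) q.1 q.2 * radialWeight q.1) ^ 2 * Real.sin (2 * q.2) ^ (2 - γ)) := by
    have c1 : Measurable fun q : ℝ × ℝ => Dz (dθ u) q.1 q.2 := (hu.ofdθ.smooth.ofDz 0).continuous.measurable
    have c2 : Measurable fun q : ℝ × ℝ => radialWeight q.1 := by unfold radialWeight; fun_prop
    have c3 : Measurable fun q : ℝ × ℝ => Real.sin (2 * q.2) ^ (2 - γ) := by fun_prop
    exact (((c1.mul c2).pow_const 2).mul c3).ennreal_ofReal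
  have mB' : Measurable fun q : ℝ × ℝ => ENNReal.ofReal (radialWeight q.1 ^ 2 * dθ (Dz^[3] v) q.1 q.2 ^ 2 * Real.sin (2 * q.2) ^ (2 - γ)) := by
    have c1 : Measurable fun q : ℝ × ℝ => dθ (Dz^[3] v) q.1 q.2 := (hv3.ofdθ.smooth 0).continuous.measurable
    have c2 : Measurable fun q : ℝ × ℝ => radialWeight q.1 := by unfold radialWeight; fun_prop
    have c3 : Measurable fun q : ℝ × ℝ => Real.sin (2 * q.2) ^ (2 - γ) := by fun_prop
    exact (((c2.pow_const 2).mul (c1.pow_const 2)).mul c3).ennreal_ofReal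
  have mA : Measurable A := mA'.lintegral_prod_left' (μ := volume.restrict (Ioi (0:ℝ)))
  have mB : Measurable B := mB'.lintegral_prod_right' (ν := volume.restrict (Ioo (0:ℝ) (π / 2)))
  -- pointwise bound on the strip
  have hpt : ∀ p ∈ strip, ENNReal.ofReal (radialWeight p.1 ^ 2 * (Dθ u p.1 p.2) ^ 2 * ((Dz^[3] v) p.1 p.2) ^ 2 * Real.sin (2 * p.2) ^ (-γ)) ≤
      (ENNReal.ofReal (1 / 3) * ENNReal.ofReal (π / (γ - 1))) * (B p.1 * A p.2) := by
    intro p hp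
    have hs : 0 < Real.sin (2 * p.2) := Real.sin_pos_of_pos_of_lt_pi (by linarith [hp.2.1]) (by linarith [hp.2.2])
    have hst : 0 ≤ Real.sin (2 * p.2) ^ (2 - γ) := Real.rpow_nonneg hs.le _
    -- `w²(D_θu)²(D_z³v)²s^{-γ} = [(∂_θu)²] · [(D_z³v)²] · (w² s^{2-γ})`
    have e0 : radialWeight p.1 ^ 2 * (Dθ u p.1 p.2) ^ 2 * ((Dz^[3] v) p.1 p.2) ^ 2 * Real.sin (2 * p.2) ^ (-γ) =
        (dθ u p.1 p.2 ^ 2) * (((Dz^[3] v) p.1 p.2) ^ 2 * radialWeight p.1 ^ 2 * Real.sin (2 * p.2) ^ (2 - γ)) := by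
      rw [Dθ_apply, show deriv (fun θ' => u p.1 θ') p.2 = dθ u p.1 p.2 from rfl]
      have e := sin_pow_mul_rpow_neg hp 1 γ
      norm_num at e
      rw [← e]; ring
    rw [e0]
    have hX : dθ u p.1 p.2 ^ 2 ≤ 1 / 3 * ∫ s in Ioi (0:ℝ), (Dz (dθ u) s p.2 * radialWeight s) ^ 2 := hu.ofdθ.sq_le_radial p.1 p.2
    have hY : ((Dz^[3] v) p.1 p.2) ^ 2 ≤ π / (γ - 1) * ∫ t in Ioo 0 (π / 2), dθ (Dz^[3] v) p.1 t ^ 2 * Real.sin (2 * t) ^ (2 - γ) := hv3.sq_le_angular hγ1 hγ2 p.1 p.2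
    have hX0 : 0 ≤ ∫ s in Ioi (0:ℝ), (Dz (dθ u) s p.2 * radialWeight s) ^ 2 := setIntegral_nonneg measurableSet_Ioi fun s _ => sq_nonneg _
    have hY0 : 0 ≤ ∫ t in Ioo 0 (π / 2), dθ (Dz^[3] v) p.1 t ^ 2 * Real.sin (2 * t) ^ (2 - γ) :=
      setIntegral_nonneg measurableSet_Ioo fun t ht => mul_nonneg (sq_nonneg _) (Real.rpow_nonneg (Real.sin_pos_of_pos_of_lt_pi (by linarith [ht.1]) (by linarith [ht.2])).le _)
    have hw0 : 0 ≤ radialWeight p.1 ^ 2 * Real.sin (2 * p.2) ^ (2 - γ) := by positivity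
    -- real inequality, then to `ℝ≥0∞`
    have hreal : (dθ u p.1 p.2 ^ 2) * (((Dz^[3] v) p.1 p.2) ^ 2 * radialWeight p.1 ^ 2 * Real.sin (2 * p.2) ^ (2 - γ)) ≤
        (1 / 3 * (π / (γ - 1))) * (((radialWeight p.1 ^ 2 * ∫ t in Ioo 0 (π / 2), dθ (Dz^[3] v) p.1 t ^ 2 * Real.sin (2 * t) ^ (2 - γ))) *
          ((∫ s in Ioi (0:ℝ), (Dz (dθ u) s p.2 * radialWeight s) ^ 2) * Real.sin (2 * p.2) ^ (2 - γ))) := by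
      have h1 : ((Dz^[3] v) p.1 p.2) ^ 2 * radialWeight p.1 ^ 2 * Real.sin (2 * p.2) ^ (2 - γ) ≤
          (π / (γ - 1) * ∫ t in Ioo 0 (π / 2), dθ (Dz^[3] v) p.1 t ^ 2 * Real.sin (2 * t) ^ (2 - γ)) * radialWeight p.1 ^ 2 * Real.sin (2 * p.2) ^ (2 - γ) := by
        rw [mul_assoc, mul_assoc (π / (γ - 1) * _)]; exact mul_le_mul_of_nonneg_right hY hw0
      calc (dθ u p.1 p.2 ^ 2) * (((Dz^[3] v) p.1 p.2) ^ 2 * radialWeight p.1 ^ 2 * Real.sin (2 * p.2) ^ (2 - γ))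
          ≤ (1 / 3 * ∫ s in Ioi (0:ℝ), (Dz (dθ u) s p.2 * radialWeight s) ^ 2) *
              ((π / (γ - 1) * ∫ t in Ioo 0 (π / 2), dθ (Dz^[3] v) p.1 t ^ 2 * Real.sin (2 * t) ^ (2 - γ)) * radialWeight p.1 ^ 2 * Real.sin (2 * p.2) ^ (2 - γ)) :=
            mul_le_mul hX h1 (mul_nonneg (mul_nonneg (sq_nonneg _) (sq_nonneg _)) hst) (mul_nonneg (by norm_num) hX0)
        _ = _ := by ring
    refine (ENNReal.ofReal_le_ofReal hreal).trans (le_of_eq ?_)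
    have n1 : (0:ℝ) ≤ 1 / 3 * (π / (γ - 1)) := mul_nonneg (by norm_num) hc1
    have n2 : (0:ℝ) ≤ radialWeight p.1 ^ 2 * ∫ t in Ioo 0 (π / 2), dθ (Dz^[3] v) p.1 t ^ 2 * Real.sin (2 * t) ^ (2 - γ) := mul_nonneg (sq_nonneg _) hY0
    rw [ENNReal.ofReal_mul n1, ENNReal.ofReal_mul (by norm_num : (0:ℝ) ≤ 1 / 3), ENNReal.ofReal_mul n2]
    congr 1
    -- `B p.1` and `A p.2` as `ofReal` of real integrals (continuous compactly supported integrands)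
    have eB : ENNReal.ofReal (radialWeight p.1 ^ 2 * ∫ t in Ioo 0 (π / 2), dθ (Dz^[3] v) p.1 t ^ 2 * Real.sin (2 * t) ^ (2 - γ)) = B p.1 := by
      rw [hB]; simp only
      rw [← MeasureTheory.integral_const_mul]
      have e2 : ∀ t, radialWeight p.1 ^ 2 * (dθ (Dz^[3] v) p.1 t ^ 2 * Real.sin (2 * t) ^ (2 - γ)) = radialWeight p.1 ^ 2 * dθ (Dz^[3] v) p.1 t ^ 2 * Real.sin (2 * t) ^ (2 - γ) :=
        fun t => by ring
      simp_rw [e2]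
      refine ofReal_integral_eq_lintegral_ofReal ?_ ?_
      · have e3 : (fun t => radialWeight p.1 ^ 2 * dθ (Dz^[3] v) p.1 t ^ 2 * Real.sin (2 * t) ^ (2 - γ)) = fun t => radialWeight p.1 ^ 2 * (dθ (Dz^[3] v) p.1 t ^ 2 * Real.sin (2 * t) ^ (2 - γ)) := by
          funext t; ring
        rw [e3]
        refine Integrable.const_mul ?_ _
        have hc : ContinuousOn (fun t => dθ (Dz^[3] v) p.1 t ^ 2 * Real.sin (2 * t) ^ (2 - γ)) (Icc 0 (π / 2)) :=
          ((((hv3.ofdθ.smooth 0).continuous.comp (Continuous.prodMk_right p.1)).pow 2).mul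
            ((Real.continuous_sin.comp (continuous_const.mul continuous_id)).rpow_const fun _ => Or.inr (by linarith))).continuousOn
        exact hc.integrableOn_Icc.mono_set Ioo_subset_Icc_self
      · rw [Filter.EventuallyLE, ae_restrict_iff' measurableSet_Ioo]
        refine ae_of_all _ fun t ht => ?_
        have : 0 ≤ Real.sin (2 * t) ^ (2 - γ) := Real.rpow_nonneg (Real.sin_pos_of_pos_of_lt_pi (by linarith [ht.1]) (by linarith [ht.2])).le _
        show (0:ℝ) ≤ _; positivity
    have eA : ENNReal.ofReal ((∫ s in Ioi (0:ℝ), (Dz (dθ u) s p.2 * radialWeight s) ^ 2) * Real.sin (2 * p.2) ^ (2 - γ)) = A p.2 := by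
      rw [hA]; simp only
      rw [← MeasureTheory.integral_mul_const]
      refine ofReal_integral_eq_lintegral_ofReal ?_ (ae_of_all _ fun s => by show (0:ℝ) ≤ _; positivity)
      refine Integrable.mul_const ?_ _
      -- `s ↦ (D_z∂_θu(s,θ)·w(s))²` is continuous with compact support in `(0,∞)` (vanishes near `0`)
      obtain ⟨h1, h2, h3⟩ := hu.ofdθ.ofDz.slice_z p.2
      obtain ⟨a, ha, hga, -⟩ := exists_pos_forall_lt_eq_zero h2 h3
      have hc : Continuous fun s => (Dz (dθ u) s p.2 * radialWeight s) ^ 2 := by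
        have e : (fun s => (Dz (dθ u) s p.2 * radialWeight s) ^ 2) = fun s => radialWeight s ^ 2 * (Dz (dθ u) s p.2) ^ 2 := by funext s; ring
        rw [e]
        refine continuous_mul_of_eq_zero_lt (u := fun s => radialWeight s ^ 2) ?_ ((h1.continuous).pow 2) ha fun s hs => by simp [hga s hs]
        unfold radialWeight
        exact ContinuousOn.pow (ContinuousOn.div (by fun_prop) (by fun_prop) fun s hs => pow_ne_zero 2 hs) 2
      have hcs : HasCompactSupport fun s => (Dz (dθ u) s p.2 * radialWeight s) ^ 2 := by
        have e : (fun s => (Dz (dθ u) s p.2 * radialWeight s) ^ 2) = fun s => (Dz (dθ u) s p.2) * (Dz (dθ u) s p.2 * radialWeight s ^ 2) := by funext s; ring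
        rw [e]; exact h2.mul_right
      exact (hc.integrable_of_hasCompactSupport hcs).integrableOn
    rw [eB, eA]
  -- integrate: `∫∫ c·B(z)A(t) = c (∫B)(∫A)`
  have hmeas : Measurable fun p : ℝ × ℝ => ENNReal.ofReal (radialWeight p.1 ^ 2 * (Dθ u p.1 p.2) ^ 2 * ((Dz^[3] v) p.1 p.2) ^ 2 * Real.sin (2 * p.2) ^ (-γ)) := by
    have c1 : Measurable fun q : ℝ × ℝ => Dθ u q.1 q.2 := (hu.ofDθ.smooth 0).continuous.measurable
    have c2 : Measurable fun q : ℝ × ℝ => radialWeight q.1 := by unfold radialWeight; fun_prop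
    have c3 : Measurable fun q : ℝ × ℝ => Real.sin (2 * q.2) ^ (-γ) := by fun_prop
    have c4 : Measurable fun q : ℝ × ℝ => (Dz^[3] v) q.1 q.2 := (hv3.smooth 0).continuous.measurable
    exact ((((c2.pow_const 2).mul (c1.pow_const 2)).mul (c4.pow_const 2)).mul c3).ennreal_ofReal
  calc ∫⁻ p in strip, ENNReal.ofReal (radialWeight p.1 ^ 2 * (Dθ u p.1 p.2) ^ 2 * ((Dz^[3] v) p.1 p.2) ^ 2 * Real.sin (2 * p.2) ^ (-γ))
      ≤ ∫⁻ p in strip, (ENNReal.ofReal (1 / 3) * ENNReal.ofReal (π / (γ - 1))) * (B p.1 * A p.2) := setLIntegral_mono' measurableSet_strip hpt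
    _ = (ENNReal.ofReal (1 / 3) * ENNReal.ofReal (π / (γ - 1))) * ((∫⁻ z in Ioi 0, B z) * ∫⁻ t in Ioo 0 (π / 2), A t) := by
        rw [← lintegral_strip_tensor mB.aemeasurable mA.aemeasurable, ← lintegral_const_mul' _ _ (ENNReal.mul_ne_top ENNReal.ofReal_ne_top ENNReal.ofReal_ne_top)]
    _ ≤ (ENNReal.ofReal (1 / 3) * ENNReal.ofReal (π / (γ - 1))) * (eHkNormSq α 4 v * eHkNormSq α 4 u) := by
        refine mul_le_mul_right (mul_le_mul' ?_ ?_) _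
        · -- `∫B = eL2Sq (hkMixedTerm 1 3 v) ≤ E(v)`
          have e : ∫⁻ z in Ioi 0, B z = eL2Sq (hkMixedTerm α 1 3 v) := by
            rw [hB, ← lintegral_strip_eq_radial_theta mB', eL2Sq_eq_lintegral_ofReal]
            refine setLIntegral_congr_fun measurableSet_strip fun q hq => ?_
            rw [sq_hkMixedTerm_one α 3 v hq]
          rw [e]; exact eL2Sq_hkMixedTerm_le α (k := 4) le_rfl (by norm_num) v
        · have e : ∫⁻ t in Ioo 0 (π / 2), A t = eL2Sq (hkMixedTerm α 1 1 u) := by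
            rw [hA, ← lintegral_strip_eq_theta_radial mA', eL2Sq_eq_lintegral_ofReal]
            refine setLIntegral_congr_fun measurableSet_strip fun q hq => ?_
            rw [sq_hkMixedTerm_one_one hu.smooth hq]; congr 1; ring
          rw [e]; exact eL2Sq_hkMixedTerm_le α (k := 4) le_rfl (by norm_num) u
    _ = ENNReal.ofReal (π / (3 * (gammaExp α - 1))) * (eHkNormSq α 4 u * eHkNormSq α 4 v) := by
        rw [← ENNReal.ofReal_mul (by norm_num), mul_comm (eHkNormSq α 4 v)]
        congr 1; congr 1; rw [hγ]; field_simp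

end Elgindi

end Literature.Analysis.FluidPDE
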